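import Literature.Analysis.Calculus.WeightedTameFunctions
import Mathlib.Algebra.BigOperators.Finprod
import HarnessLib

/-!
# Tame functions: precomposition with linear maps, finite sums, applied bounds; growth
# bookkeeping for a normalised family of cut-offs

Analysis/Calculus support file (everything proved), continuing
`Literature/Analysis/Calculus/WeightedTameFunctions.lean`.  Recall the (unnamed) tameness property
of a function `f : X → F` on an open set `U` of a real normed space with a weight `B ≥ 1`:
`ContDiffOn ℝ ∞ f U ∧ ∃ C k, ∀ x ∈ U, ∀ i ≤ 2, ‖iteratedFDerivWithin ℝ i f U x‖ ≤ C * B x ^ k`.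
We add the closure properties used to build partitions of unity with polynomially controlled
`C²` norms on cones (Borel's reduction theory):

* `tame_comp_clm_right` — PREcomposition `f ∘ L` with a continuous linear map `L` mapping `U` into
  itself along which the weight grows at most polynomially (`B (L x) ≤ C_L B(x)^{k_L}`): chain rule
  `ContinuousLinearMap.iteratedFDerivWithin_comp_right`, `‖Dⁱf(Lx) ∘ (L, …, L)‖ ≤ ‖Dⁱf(Lx)‖ ‖L‖ⁱ`;
* `tame_finset_sum` — finite sums;
* `tame_of_apply_bounds` — a smooth bounded real function whose first two derivatives satisfy the
  APPLIED bounds `‖Df(x) v‖ ≤ C B^k ‖v‖`, `‖D²f(x)(v, w)‖ ≤ C B^k ‖v‖ ‖w‖` is tame (operator norms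
  from applied bounds), and conversely `norm_fderiv_le_of_tame` reads off `‖Df(x)‖, ‖D²f(x)‖ ≤ C B^k`
  at a point of the open set;
* `pou_translate_bounds` — bookkeeping for a family of translates `χ_γ = χ ∘ a γ⁻¹` (`a` an action
  of a group by continuous linear maps) normalised by `F = ∑ᶠ_γ χ_γ`: the quotient-rule inequalities
  for `ψ_γ = χ_γ / F ∘ a γ⁻¹` (as produced pointwise from `D(1/F)`, `D²(1/F)`), polynomial bounds for
  `Dχ_δ, D²χ_δ` over a finite set `Δ` of indices carrying the family near the points of `F' ⊆ U`,
  and `|χ| ≤ 1`, `0 ≤ ψ_γ ≤ 1` give ONE polynomial bound `C B^k` for `|ψ_γ|, ‖Dψ_γ‖, ‖D²ψ_γ‖`,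
  `γ ∈ Δ`, on `F'` (explicit: `C = 6 M²`, `k = 2m` with `M = 1 + ∑_Δ |C_δ|`, `m = ∑_Δ k_δ`).

Nothing here is specific to matrices or cones; the weight is arbitrary.

## References

* L. Hörmander, *The Analysis of Linear Partial Differential Operators I*, 2nd ed. (1990), §1.4;
  R. Bott, L. W. Tu, *Differential Forms in Algebraic Topology* (1982), §II.8 (partitions of unity).
  The material is folklore.
-/

noncomputable section

open Set Filter
open scoped Topology ContDiff

namespace Literature.Analysis.Calculus

variable {X : Type*} [NormedAddCommGroup X] [NormedSpace ℝ X]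
  {F : Type*} [NormedAddCommGroup F] [NormedSpace ℝ F]
  {U : Set X} {B : X → ℝ}

/-! ### Precomposition with a continuous linear map, finite sums -/

/-- **Precomposition with a continuous linear map preserves tameness**, for a map `L` sending the
open set `U` into itself along which the weight grows at most polynomially: the chain rule
`Dⁱ(f ∘ L)(x) = Dⁱf(Lx) ∘ (L, …, L)` gives `‖Dⁱ(f ∘ L)(x)‖ ≤ ‖Dⁱf(Lx)‖ ‖L‖ⁱ ≤ C B(Lx)^k ‖L‖ⁱ`.
[folklore] -/
theorem tame_comp_clm_right (hU : IsOpen U) (hB : ∀ x ∈ U, 1 ≤ B x) (L : X →L[ℝ] X)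
    (hL : MapsTo L U U) {CL : ℝ} {kL : ℕ} (hBL : ∀ x ∈ U, B (L x) ≤ CL * B x ^ kL) {f : X → F}
    (hf : ContDiffOn ℝ ∞ f U ∧ ∃ (C : ℝ) (k : ℕ), ∀ x ∈ U, ∀ i ≤ 2,
      ‖iteratedFDerivWithin ℝ i f U x‖ ≤ C * B x ^ k) :
    ContDiffOn ℝ ∞ (fun x => f (L x)) U ∧ ∃ (C : ℝ) (k : ℕ), ∀ x ∈ U, ∀ i ≤ 2,
      ‖iteratedFDerivWithin ℝ i (fun x => f (L x)) U x‖ ≤ C * B x ^ k := by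
  obtain ⟨hf, C, k, hb⟩ := hf
  refine ⟨hf.comp L.contDiff.contDiffOn hL, |C| * |CL| ^ k * (1 + ‖L‖) ^ 2, kL * k,
    fun x hx i hi => ?_⟩
  have hpre : IsOpen (L ⁻¹' U) := hU.preimage L.continuous
  have hLx : L x ∈ U := hL hx
  have hB0 : 0 ≤ B x := zero_le_one.trans (hB x hx)
  have hBL0 : 0 ≤ B (L x) := zero_le_one.trans (hB _ hLx)
  -- the chain rule, at the point `x` of the open sets `U` and `L ⁻¹' U`
  have h := L.iteratedFDerivWithin_comp_right hf hU.uniqueDiffOn hpre.uniqueDiffOn (x := x) hLx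
    (i := i) (by exact_mod_cast le_top)
  rw [iteratedFDerivWithin_of_isOpen i hpre (show x ∈ L ⁻¹' U from hLx)] at h
  rw [iteratedFDerivWithin_of_isOpen i hU hx, show (fun x => f (L x)) = f ∘ L from rfl, h]
  have hn : ‖(iteratedFDerivWithin ℝ i f U (L x)).compContinuousLinearMap fun _ => L‖ ≤
      ‖iteratedFDerivWithin ℝ i f U (L x)‖ * ‖L‖ ^ i := by
    refine ((iteratedFDerivWithin ℝ i f U (L x)).norm_compContinuousLinearMap_le _).trans
      (le_of_eq ?_)
    rw [Finset.prod_const, Finset.card_univ, Fintype.card_fin]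
  refine hn.trans ?_
  have hBL' : B (L x) ≤ |CL| * B x ^ kL :=
    (hBL x hx).trans (mul_le_mul_of_nonneg_right (le_abs_self _) (pow_nonneg hB0 _))
  have h1 : ‖iteratedFDerivWithin ℝ i f U (L x)‖ ≤ |C| * (|CL| * B x ^ kL) ^ k :=
    (hb _ hLx i hi).trans (mul_le_mul (le_abs_self C) (pow_le_pow_left₀ hBL0 hBL' k)
      (pow_nonneg hBL0 _) (abs_nonneg C))
  have h2 : ‖L‖ ^ i ≤ (1 + ‖L‖) ^ 2 :=
    (pow_le_pow_left₀ (norm_nonneg _) (le_add_of_nonneg_left zero_le_one) i).trans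
      (pow_le_pow_right₀ (le_add_of_nonneg_right (norm_nonneg _)) hi)
  calc ‖iteratedFDerivWithin ℝ i f U (L x)‖ * ‖L‖ ^ i
      ≤ |C| * (|CL| * B x ^ kL) ^ k * (1 + ‖L‖) ^ 2 :=
        mul_le_mul h1 h2 (pow_nonneg (norm_nonneg _) _) (by positivity)
    _ = |C| * |CL| ^ k * (1 + ‖L‖) ^ 2 * B x ^ (kL * k) := by rw [mul_pow, ← pow_mul]; ring

/-- **Finite sums of tame functions are tame.** [folklore] -/
theorem tame_finset_sum (hU : IsOpen U) (hB : ∀ x ∈ U, 1 ≤ B x) {ι : Type*} (s : Finset ι)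
    {f : ι → X → F}
    (hf : ∀ a ∈ s, ContDiffOn ℝ ∞ (f a) U ∧ ∃ (C : ℝ) (k : ℕ), ∀ x ∈ U, ∀ i ≤ 2,
      ‖iteratedFDerivWithin ℝ i (f a) U x‖ ≤ C * B x ^ k) :
    ContDiffOn ℝ ∞ (fun x => ∑ a ∈ s, f a x) U ∧ ∃ (C : ℝ) (k : ℕ), ∀ x ∈ U, ∀ i ≤ 2,
      ‖iteratedFDerivWithin ℝ i (fun x => ∑ a ∈ s, f a x) U x‖ ≤ C * B x ^ k := by
  classical
  induction s using Finset.induction_on with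
  | empty =>
    simp only [Finset.sum_empty]
    exact tame_const hB (0 : F)
  | insert a s ha ih =>
    have heq : (fun x => ∑ b ∈ insert a s, f b x) = fun x => f a x + ∑ b ∈ s, f b x :=
      funext fun x => Finset.sum_insert ha
    rw [heq]
    exact tame_add hU hB (hf a (Finset.mem_insert_self a s))
      (ih fun b hb => hf b (Finset.mem_insert_of_mem hb))

/-! ### Applied bounds versus operator norms -/

/-- **A bounded smooth real function with applied bounds on its first two derivatives is tame**:
`‖Df(x) v‖ ≤ C B^k ‖v‖` and `‖D²f(x)(v, w)‖ ≤ C B^k ‖v‖ ‖w‖` for all `v, w` bound the operator norms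
of `Df(x)` and `D²f(x)` by `|C| B^k`, and `|f| ≤ C₀ ≤ |C₀| B^k`. [folklore] -/
theorem tame_of_apply_bounds (hU : IsOpen U) (hB : ∀ x ∈ U, 1 ≤ B x) {f : X → ℝ}
    (hf : ContDiffOn ℝ ∞ f U) {C₀ C : ℝ} {k : ℕ} (h0 : ∀ x ∈ U, |f x| ≤ C₀)
    (hb : ∀ x ∈ U, ∀ v w : X, ‖fderiv ℝ f x v‖ ≤ C * B x ^ k * ‖v‖ ∧
      ‖iteratedFDeriv ℝ 2 f x ![v, w]‖ ≤ C * B x ^ k * ‖v‖ * ‖w‖) :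
    ContDiffOn ℝ ∞ f U ∧ ∃ (C : ℝ) (k : ℕ), ∀ x ∈ U, ∀ i ≤ 2,
      ‖iteratedFDerivWithin ℝ i f U x‖ ≤ C * B x ^ k := by
  refine ⟨hf, |C₀| + |C|, k, fun x hx i hi => ?_⟩
  have hBk : 1 ≤ B x ^ k := one_le_pow₀ (hB x hx)
  have hs : 0 ≤ B x ^ k := zero_le_one.trans hBk
  have hCs : C * B x ^ k ≤ |C| * B x ^ k := mul_le_mul_of_nonneg_right (le_abs_self C) hs
  rw [iteratedFDerivWithin_of_isOpen i hU hx]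
  have key : ‖iteratedFDeriv ℝ i f x‖ ≤ |C₀| ∨ ‖iteratedFDeriv ℝ i f x‖ ≤ |C| * B x ^ k := by
    rcases (by omega : i = 0 ∨ i = 1 ∨ i = 2) with rfl | rfl | rfl
    · left
      rw [norm_iteratedFDeriv_zero, Real.norm_eq_abs]
      exact (h0 x hx).trans (le_abs_self _)
    · right
      rw [norm_iteratedFDeriv_one]
      exact ContinuousLinearMap.opNorm_le_bound _ (by positivity) fun v =>
        ((hb x hx v v).1).trans (mul_le_mul_of_nonneg_right hCs (norm_nonneg v))
    · right
      refine ContinuousMultilinearMap.opNorm_le_bound (by positivity) fun m => ?_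
      have hm : m = ![m 0, m 1] := by
        funext j
        fin_cases j <;> rfl
      rw [Fin.prod_univ_two]
      calc ‖iteratedFDeriv ℝ 2 f x m‖ = ‖iteratedFDeriv ℝ 2 f x ![m 0, m 1]‖ := by rw [← hm]
        _ ≤ C * B x ^ k * ‖m 0‖ * ‖m 1‖ := (hb x hx (m 0) (m 1)).2
        _ ≤ |C| * B x ^ k * ‖m 0‖ * ‖m 1‖ := by gcongr
        _ = |C| * B x ^ k * (‖m 0‖ * ‖m 1‖) := by ring
  rcases key with h | h
  · calc ‖iteratedFDeriv ℝ i f x‖ ≤ |C₀| := h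
      _ ≤ |C₀| * B x ^ k := le_mul_of_one_le_right (abs_nonneg _) hBk
      _ ≤ (|C₀| + |C|) * B x ^ k :=
          mul_le_mul_of_nonneg_right (le_add_of_nonneg_right (abs_nonneg _)) hs
  · calc ‖iteratedFDeriv ℝ i f x‖ ≤ |C| * B x ^ k := h
      _ ≤ (|C₀| + |C|) * B x ^ k :=
          mul_le_mul_of_nonneg_right (le_add_of_nonneg_left (abs_nonneg _)) hs

/-- **From the tame bounds to the operator norms of the first two derivatives** at a point of the
open set. [folklore] -/
theorem norm_fderiv_le_of_tame (hU : IsOpen U) {f : X → F} {C : ℝ} {k : ℕ} {x : X} (hx : x ∈ U)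
    (hb : ∀ i ≤ 2, ‖iteratedFDerivWithin ℝ i f U x‖ ≤ C * B x ^ k) :
    ‖fderiv ℝ f x‖ ≤ C * B x ^ k ∧ ‖iteratedFDeriv ℝ 2 f x‖ ≤ C * B x ^ k := by
  have h1 := hb 1 (by norm_num)
  have h2 := hb 2 le_rfl
  rw [iteratedFDerivWithin_of_isOpen 1 hU hx, norm_iteratedFDeriv_one] at h1
  rw [iteratedFDerivWithin_of_isOpen 2 hU hx] at h2
  exact ⟨h1, h2⟩

/-! ### Growth bookkeeping for a normalised family of translates -/

section POU

variable {Γ : Type*} [Group Γ]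

/-- **Growth of a normalised family of cut-offs.**  Let a group act on `X` by continuous linear maps
(`a`), let `χ_δ = χ ∘ a δ⁻¹` (`|χ| ≤ 1` on `U`) and `ψ_δ = χ_δ / ∑ᶠ_γ χ_γ ∘ a δ⁻¹` with `0 ≤ ψ_δ ≤ 1`
on `U`.  Suppose that at the points of `F' ⊆ U` only the `χ_γ`, `γ ∈ Δ` (finite), are alive nearby,
that there the quotient-rule inequalities
`‖Dψ_δ‖ ≤ ‖Dχ_δ‖ + |χ_δ| ∑_Δ ‖Dχ_γ‖`,
`‖D²ψ_δ‖ ≤ ‖D²χ_δ‖ + 2‖Dχ_δ‖ ∑_Δ ‖Dχ_γ‖ + |χ_δ| (∑_Δ ‖D²χ_γ‖ + 2 (∑_Δ ‖Dχ_γ‖)²)` hold, and that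
`‖Dχ_δ‖, ‖D²χ_δ‖ ≤ C_δ B^{k_δ}` on `U` for `δ ∈ Δ` (`B ≥ 1` a weight).  Then
`|ψ_γ|, ‖Dψ_γ‖, ‖D²ψ_γ‖ ≤ 6 M² B^{2m}` on `F'` for all `γ ∈ Δ`, where `M = 1 + ∑_Δ |C_δ|` and
`m = ∑_Δ k_δ`. [folklore] -/
theorem pou_translate_bounds (a : Γ →* (X →L[ℝ] X)) {F' : Set X} (hF' : F' ⊆ U) (χ : X → ℝ)
    (hB : ∀ x ∈ U, 1 ≤ B x) (Δ : Finset Γ)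
    (h01 : ∀ x ∈ U, ∀ δ : Γ, 0 ≤ χ (a δ⁻¹ x) / ∑ᶠ γ : Γ, χ (a γ⁻¹ (a δ⁻¹ x)) ∧
      χ (a δ⁻¹ x) / ∑ᶠ γ : Γ, χ (a γ⁻¹ (a δ⁻¹ x)) ≤ 1)
    (hbd : ∀ x ∈ U, ∀ s : Finset Γ,
      (∀ γ : Γ, γ ∉ s → (fun y => χ (a γ⁻¹ y)) =ᶠ[𝓝 x] fun _ => 0) → ∀ δ : Γ,
        ‖fderiv ℝ (fun y => χ (a δ⁻¹ y) / ∑ᶠ γ : Γ, χ (a γ⁻¹ (a δ⁻¹ y))) x‖ ≤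
            ‖fderiv ℝ (fun y => χ (a δ⁻¹ y)) x‖ +
              |χ (a δ⁻¹ x)| * ∑ γ ∈ s, ‖fderiv ℝ (fun y => χ (a γ⁻¹ y)) x‖ ∧
        ‖iteratedFDeriv ℝ 2 (fun y => χ (a δ⁻¹ y) / ∑ᶠ γ : Γ, χ (a γ⁻¹ (a δ⁻¹ y))) x‖ ≤
            ‖iteratedFDeriv ℝ 2 (fun y => χ (a δ⁻¹ y)) x‖ +
              2 * ‖fderiv ℝ (fun y => χ (a δ⁻¹ y)) x‖ *
                ∑ γ ∈ s, ‖fderiv ℝ (fun y => χ (a γ⁻¹ y)) x‖ +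
              |χ (a δ⁻¹ x)| * (∑ γ ∈ s, ‖iteratedFDeriv ℝ 2 (fun y => χ (a γ⁻¹ y)) x‖ +
                2 * (∑ γ ∈ s, ‖fderiv ℝ (fun y => χ (a γ⁻¹ y)) x‖) ^ 2))
    (hvan : ∀ x ∈ F', ∀ γ : Γ, γ ∉ Δ → (fun y => χ (a γ⁻¹ y)) =ᶠ[𝓝 x] fun _ => 0)
    (hχ1 : ∀ x ∈ U, ∀ δ : Γ, |χ (a δ⁻¹ x)| ≤ 1)
    (hD : ∀ δ ∈ Δ, ∃ (C : ℝ) (k : ℕ), ∀ x ∈ U,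
      ‖fderiv ℝ (fun y => χ (a δ⁻¹ y)) x‖ ≤ C * B x ^ k ∧
        ‖iteratedFDeriv ℝ 2 (fun y => χ (a δ⁻¹ y)) x‖ ≤ C * B x ^ k) :
    ∃ (C : ℝ) (k : ℕ), ∀ γ ∈ Δ, ∀ x ∈ F',
      |χ (a γ⁻¹ x) / ∑ᶠ γ' : Γ, χ (a γ'⁻¹ (a γ⁻¹ x))| ≤ C * B x ^ k ∧
      ‖fderiv ℝ (fun y => χ (a γ⁻¹ y) / ∑ᶠ γ' : Γ, χ (a γ'⁻¹ (a γ⁻¹ y))) x‖ ≤ C * B x ^ k ∧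
      ‖iteratedFDeriv ℝ 2 (fun y => χ (a γ⁻¹ y) / ∑ᶠ γ' : Γ, χ (a γ'⁻¹ (a γ⁻¹ y))) x‖ ≤
        C * B x ^ k := by
  classical
  -- a total choice of constants and exponents
  have hch : ∀ δ : Γ, ∃ (C : ℝ) (k : ℕ), δ ∈ Δ → ∀ x ∈ U,
      ‖fderiv ℝ (fun y => χ (a δ⁻¹ y)) x‖ ≤ C * B x ^ k ∧
        ‖iteratedFDeriv ℝ 2 (fun y => χ (a δ⁻¹ y)) x‖ ≤ C * B x ^ k := by
    intro δ
    by_cases hδ : δ ∈ Δ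
    · obtain ⟨C, k, h⟩ := hD δ hδ
      exact ⟨C, k, fun _ => h⟩
    · exact ⟨0, 0, fun h => absurd h hδ⟩
  choose C k hCk using hch
  set M : ℝ := 1 + ∑ δ ∈ Δ, |C δ| with hM
  set m : ℕ := ∑ δ ∈ Δ, k δ with hm
  have hM1 : 1 ≤ M := le_add_of_nonneg_right (Finset.sum_nonneg fun δ _ => abs_nonneg _)
  have hkm : ∀ δ ∈ Δ, k δ ≤ m := fun δ hδ =>
    Finset.single_le_sum (f := k) (fun δ _ => Nat.zero_le _) hδ
  -- the atoms at a point of `U`: each translate, and the two sums over `Δ`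
  have hat : ∀ x ∈ U, ∀ δ ∈ Δ, ‖fderiv ℝ (fun y => χ (a δ⁻¹ y)) x‖ ≤ |C δ| * B x ^ m ∧
      ‖iteratedFDeriv ℝ 2 (fun y => χ (a δ⁻¹ y)) x‖ ≤ |C δ| * B x ^ m := by
    intro x hx δ hδ
    have up : C δ * B x ^ k δ ≤ |C δ| * B x ^ m := tame_weaken (hB x hx) (hkm δ hδ) le_rfl
    exact ⟨((hCk δ hδ x hx).1).trans up, ((hCk δ hδ x hx).2).trans up⟩
  have hsum : ∀ x ∈ U, ∑ δ ∈ Δ, ‖fderiv ℝ (fun y => χ (a δ⁻¹ y)) x‖ ≤ M * B x ^ m ∧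
      ∑ δ ∈ Δ, ‖iteratedFDeriv ℝ 2 (fun y => χ (a δ⁻¹ y)) x‖ ≤ M * B x ^ m := by
    intro x hx
    have hs : 0 ≤ B x ^ m := pow_nonneg (zero_le_one.trans (hB x hx)) _
    have hle : (∑ δ ∈ Δ, |C δ|) * B x ^ m ≤ M * B x ^ m :=
      mul_le_mul_of_nonneg_right (le_add_of_nonneg_left zero_le_one) hs
    refine ⟨?_, ?_⟩
    · rw [Finset.sum_mul] at hle
      exact (Finset.sum_le_sum fun δ hδ => (hat x hx δ hδ).1).trans hle
    · rw [Finset.sum_mul] at hle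
      exact (Finset.sum_le_sum fun δ hδ => (hat x hx δ hδ).2).trans hle
  refine ⟨6 * M ^ 2, m + m, fun γ hγ x hx => ?_⟩
  have hxU : x ∈ U := hF' hx
  set S : ℝ := B x ^ m with hS
  have hS1 : 1 ≤ S := one_le_pow₀ (hB x hxU)
  have hpow : B x ^ (m + m) = S * S := pow_add _ _ _
  rw [hpow]
  obtain ⟨hb1, hb2⟩ := hbd x hxU Δ (hvan x hx) γ
  obtain ⟨hs1, hs2⟩ := hsum x hxU
  have hCM : |C γ| ≤ M := (Finset.single_le_sum (f := fun δ => |C δ|)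
    (fun δ _ => abs_nonneg (C δ)) hγ).trans (le_add_of_nonneg_left zero_le_one)
  have hg1 : ‖fderiv ℝ (fun y => χ (a γ⁻¹ y)) x‖ ≤ M * S :=
    ((hat x hxU γ hγ).1).trans (mul_le_mul_of_nonneg_right hCM (zero_le_one.trans hS1))
  have hg2 : ‖iteratedFDeriv ℝ 2 (fun y => χ (a γ⁻¹ y)) x‖ ≤ M * S :=
    ((hat x hxU γ hγ).2).trans (mul_le_mul_of_nonneg_right hCM (zero_le_one.trans hS1))
  have hA : |χ (a γ⁻¹ x)| ≤ 1 := hχ1 x hxU γ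
  have hA0 : 0 ≤ |χ (a γ⁻¹ x)| := abs_nonneg _
  have hMS : 1 ≤ M * S := one_le_mul_of_one_le_of_one_le hM1 hS1
  have hMS2 : M * S ≤ M * S * (M * S) := le_mul_of_one_le_right (zero_le_one.trans hMS) hMS
  have hsn : 0 ≤ ∑ δ ∈ Δ, ‖fderiv ℝ (fun y => χ (a δ⁻¹ y)) x‖ :=
    Finset.sum_nonneg fun δ _ => norm_nonneg _
  have P : |χ (a γ⁻¹ x)| * ∑ δ ∈ Δ, ‖fderiv ℝ (fun y => χ (a δ⁻¹ y)) x‖ ≤ 1 * (M * S) :=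
    mul_le_mul hA hs1 hsn zero_le_one
  have Q : ‖fderiv ℝ (fun y => χ (a γ⁻¹ y)) x‖ *
      ∑ δ ∈ Δ, ‖fderiv ℝ (fun y => χ (a δ⁻¹ y)) x‖ ≤ M * S * (M * S) :=
    mul_le_mul hg1 hs1 hsn (zero_le_one.trans hMS)
  have R : |χ (a γ⁻¹ x)| * (∑ δ ∈ Δ, ‖iteratedFDeriv ℝ 2 (fun y => χ (a δ⁻¹ y)) x‖ +
      2 * (∑ δ ∈ Δ, ‖fderiv ℝ (fun y => χ (a δ⁻¹ y)) x‖) ^ 2) ≤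
        1 * (M * S + 2 * (M * S) ^ 2) :=
    mul_le_mul hA (add_le_add hs2 (mul_le_mul_of_nonneg_left
      (pow_le_pow_left₀ hsn hs1 2) zero_le_two)) (by positivity) zero_le_one
  refine ⟨?_, hb1.trans (by linarith), hb2.trans (by linarith)⟩
  obtain ⟨h0, h1⟩ := h01 x hxU γ
  rw [abs_of_nonneg h0]
  linarith

end POU

end Literature.Analysis.Calculus
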